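import Summits.BirchSwinnertonDyer.Uniform.U2.TwoTorsionDihedralTriple
import Summits.BirchSwinnertonDyer.Uniform.U2.RingClassNoTwoTorsionPrelims
import Summits.BirchSwinnertonDyer.Rank1Residual.X11b.RingClassFieldConj
import Literature.NumberTheory.EllipticCurves.RingClassFieldConjugation
import HarnessLib

/-!
# Cell «bsd-uniform», track U2, route C — T4-PROOF Lemma L1 PROVED: `E(K[n])[2] = 0` for every
# ring class field `K[n]` of a Heegner field of odd discriminant, from (H-2) `E(ℚ)[2] = 0` alone
# (HOME/RESIDUE.md §U2 row R2-9: the binder `h2L` of the end-to-end heads becomes a theorem)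

HONEST FRAMING (cell «bsd-uniform», run/shared/lean/pub/bsd-uniform/, seat u2-p1): a THEOREM about the
Mordell–Weil torsion of `E` over the ring class fields of the Heegner field; no claim about BSD beyond
it; nothing booked, no census number moved. Route C's parity transport
(`GenusCongruence.not_isOfFinAddOrder_genusPoint` and every end-to-end head `bsdp_two_of_genusTheory_*`)
carries lemma L1 of T4-PROOF.md v1.9b §3 — "under (H-2) `E(ℚ)[2] = 0` and (H-Δ) `K ≠ ℚ(√Δ_E)`:
`E(H_c)[2] = 0` for every ring class field `H_c` of `K`" — as the BINDER
`h2L : ∀ Q ∈ E(K[|d|]), 2Q = 0 → Q = 0` (u2-p3 landed its group-theoretic half,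
`RingClassNoTwoTorsionGroup.lean`; the field half was missing). This file PROVES L1, and proves that
(H-Δ) is AUTOMATIC under the Heegner hypothesis when `d_K` is odd, so the binder disappears outright:

* §1 (the `2`-division cubic): a non-zero `2`-torsion point `(x, y) ∈ E(L)` has
  `2y + a₁x + a₃ = 0`, so `x` is a root of `4X³ + b₂X² + 2b₄X + b₆` (Silverman AEC III.§1), and
  is determined by `x` — at most three such points, and their `x`-coordinates, when three, are ALL
  the roots, whence `(16(x₁−x₂)(x₁−x₃)(x₂−x₃))² = 16·16Δ·…` precisely: Mathlib's
  `Cubic.discr_eq_prod_three_roots` with `twoTorsionPolynomial_discr` gives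
  `δ² = 16 Δ_E` for `δ = 4·4·(x₁−x₂)(x₁−x₃)(x₂−x₃)`.
* §2 (the Heegner field): in a quadratic field an irrational `k` with `k² = q ∈ ℚ` has
  `q ∈ d_K·ℚ²` (`exists_eq_sq_mul_discr`); and `Δ_E ∉ d_K·ℚ²` under the Heegner hypothesis with
  `d_K` odd (`Δ_ne_sq_mul_discr`: a prime `p ∣ d_K` — `p² ∤ d_K`, tree
  `not_sq_dvd_discr_of_prime_ne_two` — would have odd valuation in `Δ_min`, so `p ∣ Δ_min`, `p ∣ N`
  by `dvd_conductorNorm_iff_not_hasGoodReductionAtPrime`, and `p` would split in `K`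
  (`satisfiesHeegnerHypothesis_iff_kronecker`: `(d_K/p) = 1`) while `(d_K/p) = 0`). This is (H-Δ),
  discharged.
* §3 (L1): `Γ = Aut(K[n]/ℚ) ⊇ A = Gal(K[n]/K)` is generalized dihedral (tree:
  `exists_not_mem_ringClassGal_forall_mul_mul_inv_eq_inv`, `inv_mul_mem_ringClassGal_of_not_mem`,
  `commute_of_mem_ringClassGal` — Cox Lemma 9.3); no non-zero `2`-torsion point of `E(K[n])` is
  `Γ`-fixed (descent to `ℚ`, `IsGalois.mem_range_algebraMap_iff_fixed` with the tree's
  `RingClassConj.isGalois_rat_ringClassField`, and (H-2)); so by the combinatorial half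
  (`TwoTorsionDihedral.exists_triple`) a non-zero `Q ∈ E(K[n])[2]` yields `P₁, P₂, P₃` with `A³`
  trivial on them and `τ = (P₁ P₂)`; then `A` fixes `δ` (`aδ = ±δ`, `a³δ = δ`), `τδ = −δ`, so
  `δ ∈ K ∖ ℚ` (descent to `K`) with `δ² = 16Δ`, i.e. `Δ ∈ d_K ℚ²` — contradiction.
  `forall_two_nsmul_eq_zero_of_heegner`: **`E(K[n])[2] = 0`** for `W` globally minimal with
  `E(ℚ)[2] = 0`, `K` imaginary quadratic, `d_K ≡ 1 (mod 4)`, Heegner hypothesis for `N_E`, `n ≥ 1`.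

What this does NOT do: even `d_K` (there (H-Δ) can fail: `Δ = −s²`, `K = ℚ(i)`); curves with a
rational `2`-torsion point (then `E(K[n])[2] ≠ 0` trivially).

References: T4-PROOF.md v1.9b §3 L1 (HOME, b2b/bsd-rank1-residual/p2/idea-2/); Cox, *Primes of the
form x² + ny²*, 2nd ed., Lemma 9.3 [Cox2013]; Silverman, AEC 2nd ed., III.§1 and VIII.§1
[SilvermanAEC2009]; Gross 1991 §3 [GrossLMS1991]; Marcus, *Number Fields*, Ch. 2 Thm. 1 (quadratic
fields).
-/

noncomputable section

open scoped Classical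

open WeierstrassCurve NumberField Literature.NumberTheory.EllipticCurves
  Literature.NumberTheory.EllipticCurves.ModularForms

set_option autoImplicit false

namespace Summit.BirchSwinnertonDyer.Uniform.U2.RingClass

/-! ## §3 L1: no `2`-torsion over the ring class fields of the Heegner field -/

section L1

variable {K : Type} [Field K] [NumberField K]

/-- **T4-PROOF Lemma L1, PROVED.** Let `E/ℚ` have the globally minimal model `W` with
`E(ℚ)[2] = 0` ((H-2), binder `hT`), and let `K` be an imaginary quadratic field of odd discriminant
(`d_K ≡ 1 (mod 4)`) satisfying the Heegner hypothesis for the conductor of `E`. Then for every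
`n ≥ 1` the ring class field `K[n]` carries no `2`-torsion of `E`: `E(K[n])[2] = 0`. Proof:
`Γ = Aut(K[n]/ℚ) ⊇ A = Gal(K[n]/K)` is generalized dihedral (`RingClassFieldConjugation`:
`τ a τ⁻¹ = a⁻¹`, `Γ = A ∪ τA`; `A` abelian, `RingClassFieldAbelian`); a non-zero `2`-torsion point
gives, by the combinatorial half (`TwoTorsionDihedral.exists_triple`: at most three such points —
`x`-coordinates are roots of the `2`-division cubic —, none `Γ`-fixed by descent to `ℚ` and (H-2)),
three points `P₁, P₂, P₃` with `A³` trivial on them and `τ = (P₁ P₂)`; then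
`δ = 16 (x₁−x₂)(x₁−x₃)(x₂−x₃)` has `δ² = 16Δ` (`Cubic.discr_eq_prod_three_roots`,
`twoTorsionPolynomial_discr`), is fixed by `A` (`aδ = ±δ` and `a³δ = δ`) and negated by `τ`, so
`δ = √(16Δ) ∈ K ∖ ℚ`, i.e. `Δ ∈ d_K ℚ²` (`exists_eq_sq_mul_discr`) — impossible under the Heegner
hypothesis (`Δ_ne_sq_mul_discr`). This DISCHARGES the binder `h2L` (HOME/RESIDUE.md §U2 R2-9) of the
end-to-end heads for every Heegner field with odd discriminant. [folklore] -/
theorem forall_two_nsmul_eq_zero_of_heegner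
    (W : WeierstrassCurve ℚ) [W.IsElliptic] [W.IsGloballyMinimal]
    (hK : IsImaginaryQuadratic K) (ι : K →+* ℂ) (hD4 : NumberField.discr K % 4 = 1)
    (hH : SatisfiesHeegnerHypothesis (W.conductorNorm ℤ) K)
    (hT : ∀ P : W.toAffine.Point, 2 • P = 0 → P = 0)
    {n : ℕ} (hn : n ≠ 0) [NumberField (ringClassField K ι n)]
    (Q : (W.baseChange (ringClassField K ι n : Type)).toAffine.Point) (hQ2 : (2 : ℕ) • Q = 0) :
    Q = 0 := by
  by_contra hQ0
  haveI : IsGalois ℚ (ringClassField K ι n) :=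
    Summit.BirchSwinnertonDyer.Rank1Residual.X11b.RingClassConj.isGalois_rat_ringClassField hK ι hn
  have hKL := finiteDimensional_and_isGalois_ringClassField hK ι hn
  -- the dihedral structure of `Aut(K[n]/ℚ) ⊇ Gal(K[n]/K)`
  obtain ⟨τ, hτA, hconj⟩ := exists_not_mem_ringClassGal_forall_mul_mul_inv_eq_inv hK ι hn
  have hcomm : ∀ a ∈ ringClassGal ι n, ∀ b ∈ ringClassGal ι n, a * b = b * a :=
    fun a ha b hb => commute_of_mem_ringClassGal hK hn ha hb
  have hcover : ∀ g : ringClassField K ι n ≃ₐ[ℚ] ringClassField K ι n,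
      g ∈ ringClassGal ι n ∨ τ⁻¹ * g ∈ ringClassGal ι n := fun g => by
    by_cases hg : g ∈ ringClassGal ι n
    · exact Or.inl hg
    · exact Or.inr (inv_mul_mem_ringClassGal_of_not_mem hK ι n hτA hg)
  -- coordinates of the image of a point
  have hcoord : ∀ (σ : ringClassField K ι n ≃ₐ[ℚ] ringClassField K ι n)
      {x y x' y' : ringClassField K ι n} {h : (W.baseChange (ringClassField K ι n : Type)).toAffine.Nonsingular x y}
      {h' : (W.baseChange (ringClassField K ι n : Type)).toAffine.Nonsingular x' y'},
      pointGalHom W (ringClassField K ι n) σ (Affine.Point.some x y h) = Affine.Point.some x' y' h' →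
        σ x = x' ∧ σ y = y' := by
    intro σ x y x' y' h h' he
    rw [pointGalHom_apply, Affine.Point.map_some, Affine.Point.some.injEq] at he
    exact he
  -- no non-zero `2`-torsion point is fixed by all of `Aut(K[n]/ℚ)`: descent to `ℚ` and (H-2)
  have hfix : ∀ P : (W.baseChange (ringClassField K ι n : Type)).toAffine.Point,
      P ≠ 0 ∧ (2 : ℕ) • P = 0 → ∃ g, pointGalHom W (ringClassField K ι n) g P ≠ P := by
    rintro P ⟨hP0, hP2⟩
    by_contra hcon
    push Not at hcon
    rcases P with _ | ⟨x, y, hxy⟩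
    · exact hP0 rfl
    · have hfx : ∀ g : ringClassField K ι n ≃ₐ[ℚ] ringClassField K ι n, g x = x ∧ g y = y :=
        fun g => hcoord g (hcon g)
      obtain ⟨x₀, hx₀⟩ := (IsGalois.mem_range_algebraMap_iff_fixed x).mpr (fun g => (hfx g).1)
      obtain ⟨y₀, hy₀⟩ := (IsGalois.mem_range_algebraMap_iff_fixed y).mpr (fun g => (hfx g).2)
      have hψ := two_mul_y_add_eq_zero W hxy hP2
      have hneg : y = (W.baseChange (ringClassField K ι n : Type)).toAffine.negY x y := by
        rw [Affine.negY]; linear_combination hψ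
      subst hx₀ hy₀
      have h₀ : W.toAffine.Nonsingular x₀ y₀ :=
        (Affine.map_nonsingular (W := W.toAffine) (algebraMap ℚ _).injective x₀ y₀).mp hxy
      have hneg₀ : y₀ = W.toAffine.negY x₀ y₀ := (algebraMap ℚ (ringClassField K ι n)).injective (by
        rw [← Affine.map_negY (W' := W.toAffine) (algebraMap ℚ (ringClassField K ι n)) x₀ y₀]
        exact hneg)
      have h2P₀ : 2 • (Affine.Point.some x₀ y₀ h₀) = 0 := by
        rw [two_nsmul, add_eq_zero_iff_eq_neg, Affine.Point.neg_some, Affine.Point.some.injEq]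
        exact ⟨rfl, hneg₀⟩
      exact Affine.Point.some_ne_zero h₀ (hT _ h2P₀)
  -- at most three non-zero `2`-torsion points: the `x`-coordinate into the roots of the cubic
  obtain ⟨P₁, P₂, P₃, hP₁, hP₂, hP₃, h12, h13, h23, -, hcube, hτ₁, hτ₂, hτ₃⟩ :=
    TwoTorsionDihedral.exists_triple (ρ := pointGalHom W (ringClassField K ι n)) hcomm hconj hτA
      hcover hfix
      (fun P => match P with
        | .zero => (0 : ringClassField K ι n)
        | .some x _ _ => x)
      (Cubic.map (algebraMap ℚ (ringClassField K ι n)) W.twoTorsionPolynomial).roots.toFinset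
      Cubic.card_roots_le
      (by
        rintro P ⟨hP0, hP2⟩
        rcases P with _ | ⟨x, y, hxy⟩
        · exact absurd rfl hP0
        · exact Multiset.mem_toFinset.mpr (mem_roots_of_two_nsmul_eq_zero W hxy hP2))
      (by
        rintro P P' ⟨hP0, -⟩ ⟨hP0', hP2'⟩ h
        rcases P with _ | ⟨x, y, hxy⟩
        · exact absurd rfl hP0
        rcases P' with _ | ⟨x', y', hxy'⟩
        · exact absurd rfl hP0'
        exact eq_of_x_eq W hP2' h)
      ⟨hQ0, hQ2⟩
  rcases P₁ with _ | ⟨x₁, y₁, e₁⟩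
  · exact hP₁.1 rfl
  rcases P₂ with _ | ⟨x₂, y₂, e₂⟩
  · exact hP₂.1 rfl
  rcases P₃ with _ | ⟨x₃, y₃, e₃⟩
  · exact hP₃.1 rfl
  have hx12 : x₁ ≠ x₂ := fun h => h12 (eq_of_x_eq W hP₂.2 h)
  have hx13 : x₁ ≠ x₃ := fun h => h13 (eq_of_x_eq W hP₃.2 h)
  have hx23 : x₂ ≠ x₃ := fun h => h23 (eq_of_x_eq W hP₃.2 h)
  -- the roots of the `2`-division cubic are exactly `x₁, x₂, x₃`
  have hroots : (Cubic.map (algebraMap ℚ (ringClassField K ι n)) W.twoTorsionPolynomial).roots =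
      {x₁, x₂, x₃} := by
    symm
    apply Multiset.eq_of_le_of_card_le
    · apply (Multiset.le_iff_subset _).mpr
      · intro x hx
        simp only [Multiset.insert_eq_cons, Multiset.mem_cons, Multiset.mem_singleton] at hx
        rcases hx with rfl | rfl | rfl
        · exact mem_roots_of_two_nsmul_eq_zero W e₁ hP₁.2
        · exact mem_roots_of_two_nsmul_eq_zero W e₂ hP₂.2
        · exact mem_roots_of_two_nsmul_eq_zero W e₃ hP₃.2
      · simp [hx12, hx13, hx23]
    · have hcard := Polynomial.card_roots'
        (Cubic.map (algebraMap ℚ (ringClassField K ι n)) W.twoTorsionPolynomial).toPoly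
      rw [Cubic.natDegree_of_a_ne_zero (by simp [Cubic.map, twoTorsionPolynomial])] at hcard
      simpa [Cubic.roots] using hcard
  -- `δ² = 16 Δ`
  have hdisc := Cubic.discr_eq_prod_three_roots (φ := algebraMap ℚ (ringClassField K ι n))
    (P := W.twoTorsionPolynomial) (by simp [twoTorsionPolynomial]) hroots
  rw [twoTorsionPolynomial_discr] at hdisc
  have h4 : (W.twoTorsionPolynomial).a = 4 := rfl
  rw [h4] at hdisc
  set δ : ringClassField K ι n := algebraMap ℚ (ringClassField K ι n) 4 *
    algebraMap ℚ (ringClassField K ι n) 4 * (x₁ - x₂) * (x₁ - x₃) * (x₂ - x₃) with hδ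
  have hδ0 : δ ≠ 0 := by
    have h4' : algebraMap ℚ (ringClassField K ι n) 4 ≠ 0 := by
      rw [Ne, map_eq_zero]; norm_num
    simp only [hδ]
    exact mul_ne_zero (mul_ne_zero (mul_ne_zero (mul_ne_zero h4' h4') (sub_ne_zero.mpr hx12))
      (sub_ne_zero.mpr hx13)) (sub_ne_zero.mpr hx23)
  -- `τ` negates `δ`
  have hτδ : τ δ = -δ := by
    obtain ⟨h1, -⟩ := hcoord τ hτ₁
    obtain ⟨h2, -⟩ := hcoord τ hτ₂
    obtain ⟨h3, -⟩ := hcoord τ hτ₃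
    simp only [hδ, map_mul, map_sub, AlgEquiv.commutes, h1, h2, h3]
    ring
  -- `Gal(K[n]/K)` fixes `δ`
  have hAδ : ∀ a ∈ ringClassGal ι n, a δ = δ := by
    intro a ha
    have hsq : (a δ) ^ 2 = δ ^ 2 := by rw [← map_pow, ← hdisc, AlgEquiv.commutes]
    rcases sq_eq_sq_iff_eq_or_eq_neg.mp hsq with h | h
    · exact h
    · exfalso
      have hc := fun (x y : ringClassField K ι n) (e) (hP : Affine.Point.some x y e ≠ 0 ∧
          (2 : ℕ) • Affine.Point.some x y e = 0) => by
        have h3 := hcube a ha _ hP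
        rw [← TwoTorsionDihedral.mul_apply, ← TwoTorsionDihedral.mul_apply] at h3
        exact (hcoord (a * (a * a)) h3).1
      have hc1 := hc x₁ y₁ e₁ hP₁
      have hc2 := hc x₂ y₂ e₂ hP₂
      have hc3 := hc x₃ y₃ e₃ hP₃
      simp only [AlgEquiv.mul_apply] at hc1 hc2 hc3
      have h3 : a (a (a δ)) = δ := by
        simp only [hδ, map_mul, map_sub, AlgEquiv.commutes, hc1, hc2, hc3]
      rw [h, map_neg, h, neg_neg, h] at h3
      exact hδ0 (CharZero.neg_eq_self_iff.mp h3)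
  -- descent to `K`: `δ = k ∈ K`, `k ∉ ℚ`, `k² = 16Δ`
  obtain ⟨k, hk⟩ : δ ∈ Set.range (algebraMap K (ringClassField K ι n)) := by
    haveI := hKL.1
    haveI := hKL.2
    exact (IsGalois.mem_range_algebraMap_iff_fixed δ).mpr
      (fun f => hAδ (f.restrictScalars ℚ) (restrictScalars_mem_ringClassGal ι n f))
  have hkirr : k ∉ Set.range (algebraMap ℚ K) := by
    rintro ⟨q, rfl⟩
    have hδq : δ = algebraMap ℚ (ringClassField K ι n) q := by
      rw [← hk, eq_ratCast (algebraMap ℚ K), map_ratCast, eq_ratCast]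
    have : τ δ = δ := by rw [hδq, AlgEquiv.commutes]
    rw [hτδ] at this
    exact hδ0 (CharZero.neg_eq_self_iff.mp this)
  have hk2 : k ^ 2 = algebraMap ℚ K (16 * W.Δ) := by
    apply (algebraMap K (ringClassField K ι n)).injective
    rw [map_pow, hk, ← hdisc, eq_ratCast (algebraMap ℚ K), map_ratCast, eq_ratCast]
  obtain ⟨r, hr⟩ := exists_eq_sq_mul_discr hK.1 hkirr hk2
  exact Δ_ne_sq_mul_discr W hK hD4 hH (r / 4) (by rw [div_pow]; linarith)

end L1

end Summit.BirchSwinnertonDyer.Uniform.U2.RingClass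

end
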